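import Literature.NumberTheory.ComplexMultiplication.CMOrderCohenMacaulayTypeTwo
import Literature.NumberTheory.ComplexMultiplication.CMOrderGorensteinWeakClassesCount
import HarnessLib

/-!
# Weak equivalence classes of an order of type two: `#W̄(𝔯) = 2^N` and `#ICM_𝔯(𝔯) = 2^N · #Pic(𝔯)`, `N` the number
# of primes of type `2` (MARSEGLIA 2024 COROLLARY 6.5 = MAIN THEOREM 3 (2), with LEMMA 6.4's patching)

Family `hodge`, lane `lit-hodgefound` (Track 2 foundations library; seat p15, row g28-#3), topic
`Literature/NumberTheory/ComplexMultiplication`, namespace `Literature.NumberTheory.ComplexMultiplication.CMTypeLattice`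
(the order `𝔯 = endOrder (M_μ)` of a number field of any degree; `T = 𝔯ᵗ` with `↑T = traceDual ℤ ℚ ↑1`; the local type
`type_𝔭(𝔯) = finrank (𝔯 ⧸ 𝔭) (↥↑T ⧸ 𝔭 • ⊤)`).  THEOREMS ONLY: no definition, no instance, no named fact (net Literature debt
`0`).  Carriers BY NAME, as in `CMOrderWeakClassesCount` / `CMOrderGorensteinWeakClassesCount` (g25-#4/#5): the stratum of
the order itself is the subtype `{I // I ≠ 0 ∧ ((I:I) : Set K) = 𝔯}`, `W̄(𝔯) = W̄k(𝔯)` is its `Quot` by weak equivalence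
`1 ∈ (I:N)(N:I)`, `ICM_𝔯(𝔯)` its `Quot` by `I = xN`, `Pic(𝔯)` the `Quot` of the invertible ones; «`I_𝔭 ≃ J_𝔭`» is
`∃ x ≠ 0, I_𝔭 = x·J_𝔭` (`CMOrderPEquivalenceLocalIsomorphism`).

## Source, VERBATIM

S. Marseglia, *Cohen-Macaulay type of orders, generators and ideal classes*, J. Algebra 658 (2024) 247–276
[Marseglia2024CMType] (arXiv:2206.03758, held `paper:arxiv-2206.03758`), §6, chunks p0014–p0015:

> "Lemma 6.4. Let `S` be an order and let `𝔭₁, …, 𝔭_r` be distinct primes of `S`. Let `I₁, …, I_r` be fractional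
> `S`-ideals contained in `S` […]. Put `J := Σ_i ((I_i + 𝔭_i^{m_i}) ∏_{j≠i} 𝔭_j^{m_j})`. Then for each `1 ≤ k ≤ r` we have
> `J_{𝔭_k} = I_{k,𝔭_k}`."
> "Corollary 6.5. Let `S ⊆ T` be orders such that `type(T) = 2`. Let `N` be the number of primes `𝔭` of `T` such that
> `type_𝔭(T) = 2`. Then `#𝒲_T(S) = 2^N` and `#ICM_T(S) = 2^N · #Pic(T)`.  Proof. The statement follows from
> Theorem 6.2 and Lemma 6.4."

and §1, chunk p0003, Main Theorem 3 (2): "Assume that `type(S) = 2`. Let `N` be the number of primes `𝔭` of `S` such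
that `type_𝔭(S) = 2`. Then `|ICM_S(S)| = 2^N · |Pic(S)|`"; §5, chunk p0013: "We say that two fractional `S`-ideals `I`
and `J` are weakly equivalent if `I_𝔭 ≃ J_𝔭` for every prime `𝔭` of `S`. […] `W_T(S)` is the subset of `W(S)` consisting
of the classes with multiplicator ring equal to `T`."

## What is formalised (the case `T = S = 𝔯`; a fractional `S`-ideal with multiplicator ring `T` is a `T`-ideal)

* §1 local tools: `exists_ne_zero_span_coe_eq_of_isPrincipal` (two nonzero principal local components differ by a
  unit of `K`), `exists_ne_zero_span_coe_eq_of_span_coe_eq` (two ideals locally isomorphic to a third are locally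
  isomorphic), `isPrincipal_span_coe_iff_of_span_coe_eq` (principality of `I_𝔭` is an invariant of «`I_𝔭 ≃ N_𝔭`»),
  `isPrincipal_span_coe_iff_of_one_mem_div_mul_div` (… hence of the weak class), the conductor test
  `conductorIdeal_le_of_finrank_traceDual_quotient_eq_two` (a prime of type `2` is singular) and the finiteness of the
  primes of type `2` (`finite_setOf_finrank_traceDual_quotient_eq_two`).
* §2 **THEOREM 6.2 read on weak classes: when `type_𝔭(𝔯) ≤ 2` everywhere, two ideals of the stratum are weakly
  equivalent iff `I_𝔭` and `N_𝔭` are simultaneously principal at every prime of type `2`**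
  (`one_mem_div_mul_div_iff_forall_isPrincipal_iff`).
* §3 **LEMMA 6.4 / the patching: every pattern of «principal / not principal» at the primes of type `2` is realised by
  an ideal with multiplicator ring `𝔯`** (`exists_div_self_eq_one_forall_isPrincipal_iff`, from
  `CMOrderIdealPrescribedLocalComponents` with local models `𝔯` and `𝔯ᵗ`).
* §4 **COROLLARY 6.5 = MAIN THEOREM 3 (2): `natCard_quot_stratum_weak_eq_two_pow` (`#W̄(𝔯) = 2^N`) and
  `natCard_quot_stratum_eq_two_pow_mul_natCard_quot_pic` (`#ICM_𝔯(𝔯) = 2^N · #Pic(𝔯)`)**, `N = #{𝔭 : type_𝔭(𝔯) = 2}`,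
  for an order with `type_𝔭(𝔯) ≤ 2` at every prime.

NOT formalised here: the relative version `S ⊊ T` (an over-order `T` of `S` as base order).
-/

noncomputable section

open scoped nonZeroDivisors NumberField Pointwise
open NumberField Module FractionalIdeal
open Submodule (traceDual)

namespace Literature.NumberTheory.ComplexMultiplication

/-! ## §1 Local tools over any domain -/

namespace NumberRing

section AnyDomain

variable {R : Type*} [CommRing R] [IsDomain R] {K : Type*} [Field K] [Algebra R K] [IsFractionRing R K]

omit [IsDomain R] [IsFractionRing R K] in
/-- **Two nonzero principal local components are isomorphic: `I_𝔭 = gA`, `N_𝔭 = g′A` (`g′ ≠ 0`) `⟹ I_𝔭 = (g/g′)·N_𝔭`.**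
[cite: Marseglia2024CMType, §6 Thm. 6.2 («`I_𝔭 ≃ S_𝔭`»), p. 13] [cite: Marseglia2025LocalIsomorphism, §3 Prop. 3.2 (2), p. 6] -/
theorem exists_ne_zero_span_coe_eq_of_isPrincipal (A : Subalgebra R K) {I N : Submodule R K}
    (hI : Submodule.span A (I : Set K) ≠ ⊥) (hN : Submodule.span A (N : Set K) ≠ ⊥)
    (hIp : (Submodule.span A (I : Set K)).IsPrincipal) (hNp : (Submodule.span A (N : Set K)).IsPrincipal) :
    ∃ x : K, x ≠ 0 ∧ Submodule.span A (I : Set K) = Submodule.span A {x} * Submodule.span A (N : Set K) := by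
  obtain ⟨g, hg⟩ := hIp.principal
  obtain ⟨g', hg'⟩ := hNp.principal
  have hg0 : g ≠ 0 := fun h ↦ hI (by rw [hg, h, Submodule.span_singleton_eq_bot])
  have hg'0 : g' ≠ 0 := fun h ↦ hN (by rw [hg', h, Submodule.span_singleton_eq_bot])
  refine ⟨g * g'⁻¹, mul_ne_zero hg0 (inv_ne_zero hg'0), ?_⟩
  rw [hg, hg', Submodule.span_mul_span, Set.singleton_mul_singleton, inv_mul_cancel_right₀ hg'0]

omit [IsDomain R] [IsFractionRing R K] in
/-- **Two ideals locally isomorphic to a third are locally isomorphic: `I_𝔭 = x·L_𝔭`, `N_𝔭 = y·L_𝔭` (`y ≠ 0`)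
`⟹ I_𝔭 = (x/y)·N_𝔭`** («`I_𝔭 ≃ (Sᵗ)_𝔭`» for both). [cite: Marseglia2024CMType, §6 Thm. 6.2 and Cor. 6.5 (proof), pp. 13–15] -/
theorem exists_ne_zero_span_coe_eq_of_span_coe_eq (A : Subalgebra R K) {I N L : Submodule R K} {x y : K}
    (hx : x ≠ 0) (hy : y ≠ 0)
    (hI : Submodule.span A (I : Set K) = Submodule.span A {x} * Submodule.span A (L : Set K))
    (hN : Submodule.span A (N : Set K) = Submodule.span A {y} * Submodule.span A (L : Set K)) :
    ∃ z : K, z ≠ 0 ∧ Submodule.span A (I : Set K) = Submodule.span A {z} * Submodule.span A (N : Set K) := by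
  refine ⟨x * y⁻¹, mul_ne_zero hx (inv_ne_zero hy), ?_⟩
  rw [hI, hN, ← mul_assoc]
  conv_rhs => rw [Submodule.span_mul_span, Set.singleton_mul_singleton, inv_mul_cancel_right₀ hy]

omit [IsDomain R] [IsFractionRing R K] in
/-- **Principality of the local component is an invariant of the local isomorphism class: `I_𝔭 = x·N_𝔭` (`x ≠ 0`)
`⟹ (I_𝔭 principal ⟺ N_𝔭 principal)`.** [cite: Marseglia2025LocalIsomorphism, §3 Def. 3.1 / Prop. 3.2, p. 6] -/
theorem isPrincipal_span_coe_iff_of_span_coe_eq (A : Subalgebra R K) {I N : Submodule R K} {x : K} (hx : x ≠ 0)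
    (h : Submodule.span A (I : Set K) = Submodule.span A {x} * Submodule.span A (N : Set K)) :
    (Submodule.span A (I : Set K)).IsPrincipal ↔ (Submodule.span A (N : Set K)).IsPrincipal := by
  have h' : Submodule.span A (N : Set K) = Submodule.span A {x⁻¹} * Submodule.span A (I : Set K) := by
    rw [h, ← mul_assoc, Submodule.span_mul_span, Set.singleton_mul_singleton, inv_mul_cancel₀ hx,
      ← Submodule.one_eq_span, one_mul]
  constructor
  · rintro ⟨g, hg⟩
    refine ⟨x⁻¹ * g, ?_⟩
    rw [h', hg, Submodule.span_mul_span, Set.singleton_mul_singleton]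
  · rintro ⟨g, hg⟩
    refine ⟨x * g, ?_⟩
    rw [h, hg, Submodule.span_mul_span, Set.singleton_mul_singleton]

end AnyDomain

end NumberRing

namespace CMTypeLattice

variable {K : Type} [Field K] [NumberField K]
variable {ι : Type} [Fintype ι] [DecidableEq ι] [Nonempty ι] (μ : Basis ι ℚ K)
variable [IsFractionRing (endOrder (Algebra.leftMulMatrix μ)) K]

/-- **Weakly equivalent ideals are locally isomorphic everywhere, so «`I_𝔭` principal» is an invariant of the weak
class** (`1 ∈ (I:N)(N:I) ⟹ 1 ∈ (I:N)(N:I) + 𝔭 ⟹ I_𝔭 = x·N_𝔭`, Marseglia 2025 Prop. 3.2). [cite: Marseglia2024CMType, §5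
(«`I` and `J` are weakly equivalent if `I_𝔭 ≃ J_𝔭` for every prime `𝔭`»), p. 13] [cite: Marseglia2025LocalIsomorphism,
§3 Prop. 3.2, p. 6] -/
theorem isPrincipal_span_coe_iff_of_one_mem_div_mul_div {I N : FractionalIdeal (endOrder (Algebra.leftMulMatrix μ))⁰ K}
    (hI : I ≠ 0) (hN : N ≠ 0) (h : (1 : K) ∈ I / N * (N / I)) (𝔭 : Ideal (endOrder (Algebra.leftMulMatrix μ)))
    [𝔭.IsMaximal] :
    (Submodule.span (Localization.subalgebra.ofField K 𝔭.primeCompl 𝔭.primeCompl_le_nonZeroDivisors)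
        (I : Set K)).IsPrincipal ↔
      (Submodule.span (Localization.subalgebra.ofField K 𝔭.primeCompl 𝔭.primeCompl_le_nonZeroDivisors)
        (N : Set K)).IsPrincipal := by
  have h𝔭 : (1 : K) ∈ I / N * (N / I) + (𝔭 : FractionalIdeal (endOrder (Algebra.leftMulMatrix μ))⁰ K) := by
    rw [← mem_coe, coe_add]
    exact Submodule.mem_sup_left h
  obtain ⟨x, hx0, hx⟩ := exists_ne_zero_span_coe_eq_of_one_mem_add_coeIdeal μ hI hN 𝔭 h𝔭
  rw [← coeToSet_coeToSubmodule, ← coeToSet_coeToSubmodule] at hx ⊢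
  exact NumberRing.isPrincipal_span_coe_iff_of_span_coe_eq _ hx0 hx

/-- **A prime of type `2` is singular: `type_𝔭(𝔯) = 2 ⟹ 𝔣 ⊆ 𝔭`** (at a regular prime the type is `1`, PROP. 3.3).
[cite: Marseglia2024CMType, §3 Prop. 3.3, p. 9] -/
theorem conductorIdeal_le_of_finrank_traceDual_quotient_eq_two
    {T : FractionalIdeal (endOrder (Algebra.leftMulMatrix μ))⁰ K}
    (hT : (T : Submodule (endOrder (Algebra.leftMulMatrix μ)) K) =
      traceDual ℤ ℚ ((1 : FractionalIdeal (endOrder (Algebra.leftMulMatrix μ))⁰ K) :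
        Submodule (endOrder (Algebra.leftMulMatrix μ)) K))
    {𝔭 : Ideal (endOrder (Algebra.leftMulMatrix μ))} [𝔭.IsPrime] (h0 : 𝔭 ≠ ⊥)
    (h2 : Module.finrank (endOrder (Algebra.leftMulMatrix μ) ⧸ 𝔭)
      ((T : Submodule (endOrder (Algebra.leftMulMatrix μ)) K) ⧸
        (𝔭 • ⊤ : Submodule (endOrder (Algebra.leftMulMatrix μ))
          (T : Submodule (endOrder (Algebra.leftMulMatrix μ)) K))) = 2) :
    EndOrder.conductorIdeal (Algebra.leftMulMatrix μ) ≤ 𝔭 := by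
  by_contra hreg
  have h1 := finrank_traceDual_quotient_eq_one_of_not_conductorIdeal_le μ hT h0 hreg
  omega

/-- **Only finitely many primes have type `2`** (they all contain the conductor). [cite: Marseglia2024CMType, §3
Prop. 3.3 («`type_𝔭(S) = 1` for almost all primes»), p. 9] -/
theorem finite_setOf_finrank_traceDual_quotient_eq_two
    {T : FractionalIdeal (endOrder (Algebra.leftMulMatrix μ))⁰ K}
    (hT : (T : Submodule (endOrder (Algebra.leftMulMatrix μ)) K) =
      traceDual ℤ ℚ ((1 : FractionalIdeal (endOrder (Algebra.leftMulMatrix μ))⁰ K) :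
        Submodule (endOrder (Algebra.leftMulMatrix μ)) K)) :
    {𝔭 : MaximalSpectrum (endOrder (Algebra.leftMulMatrix μ)) |
      Module.finrank (endOrder (Algebra.leftMulMatrix μ) ⧸ 𝔭.asIdeal)
        ((T : Submodule (endOrder (Algebra.leftMulMatrix μ)) K) ⧸
          (𝔭.asIdeal • ⊤ : Submodule (endOrder (Algebra.leftMulMatrix μ))
            (T : Submodule (endOrder (Algebra.leftMulMatrix μ)) K))) = 2}.Finite := by
  haveI := isNoetherianRing_endOrder (Algebra.leftMulMatrix μ)
  haveI := dimensionLEOne_endOrder (Algebra.leftMulMatrix μ)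
  refine (NumberRing.finite_setOf_le (EndOrder.conductorIdeal_ne_bot (Algebra.leftMulMatrix μ))).subset
    fun 𝔭 h𝔭 ↦ ?_
  haveI := 𝔭.isMaximal
  exact conductorIdeal_le_of_finrank_traceDual_quotient_eq_two μ hT
    (Ring.ne_bot_of_isMaximal_of_not_isField 𝔭.isMaximal EndOrder.not_isField) h𝔭

omit [Nonempty ι] in
/-- Membership in the stratum of the order itself: `((I:I) : Set K) = 𝔯 ⟺ (I:I) = 1`. [cite: Marseglia2019, §4 Def.
4.2, p. 8] -/
theorem coe_div_self_eq_coe_endOrder_iff {I : FractionalIdeal (endOrder (Algebra.leftMulMatrix μ))⁰ K} :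
    ((I / I : FractionalIdeal (endOrder (Algebra.leftMulMatrix μ))⁰ K) : Set K) =
      (endOrder (Algebra.leftMulMatrix μ) : Set K) ↔ I / I = 1 :=
  coe_div_self_eq_iff_div_self_eq μ (coe_one_eq_coe_endOrder μ)

/-! ## §2 THEOREM 6.2 on weak classes: the class is determined by the pattern of principality at the primes of type 2 -/

/-- **If `type_𝔭(𝔯) ≤ 2` at every prime, two ideals `I`, `N` with multiplicator ring `𝔯` are locally isomorphic at `𝔭`
as soon as `I_𝔭` and `N_𝔭` are simultaneously principal or not** (at type `1` both are principal; at type `2` both are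
`≃ 𝔯_𝔭` or both `≃ 𝔯ᵗ_𝔭`, THEOREM 6.2). [cite: Marseglia2024CMType, §6 Thm. 6.2 and Cor. 6.5 (proof), pp. 13–15] -/
theorem exists_ne_zero_span_coe_eq_of_isPrincipal_iff {T : FractionalIdeal (endOrder (Algebra.leftMulMatrix μ))⁰ K}
    (hT : (T : Submodule (endOrder (Algebra.leftMulMatrix μ)) K) =
      traceDual ℤ ℚ ((1 : FractionalIdeal (endOrder (Algebra.leftMulMatrix μ))⁰ K) :
        Submodule (endOrder (Algebra.leftMulMatrix μ)) K))
    {𝔭 : Ideal (endOrder (Algebra.leftMulMatrix μ))} [h𝔭 : 𝔭.IsPrime] (h0 : 𝔭 ≠ ⊥)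
    (h2 : Module.finrank (endOrder (Algebra.leftMulMatrix μ) ⧸ 𝔭)
      ((T : Submodule (endOrder (Algebra.leftMulMatrix μ)) K) ⧸
        (𝔭 • ⊤ : Submodule (endOrder (Algebra.leftMulMatrix μ))
          (T : Submodule (endOrder (Algebra.leftMulMatrix μ)) K))) ≤ 2)
    {I N : FractionalIdeal (endOrder (Algebra.leftMulMatrix μ))⁰ K} (hI : I ≠ 0) (hII : I / I = 1) (hN : N ≠ 0)
    (hNN : N / N = 1)
    (hiff : (Submodule.span (Localization.subalgebra.ofField K 𝔭.primeCompl 𝔭.primeCompl_le_nonZeroDivisors)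
        (I : Set K)).IsPrincipal ↔
      (Submodule.span (Localization.subalgebra.ofField K 𝔭.primeCompl 𝔭.primeCompl_le_nonZeroDivisors)
        (N : Set K)).IsPrincipal) :
    ∃ x : K, x ≠ 0 ∧
      Submodule.span (Localization.subalgebra.ofField K 𝔭.primeCompl 𝔭.primeCompl_le_nonZeroDivisors) (I : Set K) =
        Submodule.span (Localization.subalgebra.ofField K 𝔭.primeCompl 𝔭.primeCompl_le_nonZeroDivisors) {x} *
          Submodule.span (Localization.subalgebra.ofField K 𝔭.primeCompl 𝔭.primeCompl_le_nonZeroDivisors)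
            (N : Set K) := by
  set A := Localization.subalgebra.ofField K 𝔭.primeCompl 𝔭.primeCompl_le_nonZeroDivisors with hA
  haveI := isMaximal_of_isPrime_endOrder (Algebra.leftMulMatrix μ) h𝔭 h0
  have hIb : Submodule.span A (((I : Submodule (endOrder (Algebra.leftMulMatrix μ)) K) : Set K)) ≠ ⊥ := fun h ↦ by
    obtain ⟨z, hz, hz0⟩ := Submodule.exists_mem_ne_zero_of_ne_bot (fun hb ↦ hI (coeToSubmodule_eq_bot.1 hb))
    exact hz0 ((Submodule.mem_bot A).1 (h ▸ Submodule.subset_span hz))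
  have hNb : Submodule.span A (((N : Submodule (endOrder (Algebra.leftMulMatrix μ)) K) : Set K)) ≠ ⊥ := fun h ↦ by
    obtain ⟨z, hz, hz0⟩ := Submodule.exists_mem_ne_zero_of_ne_bot (fun hb ↦ hN (coeToSubmodule_eq_bot.1 hb))
    exact hz0 ((Submodule.mem_bot A).1 (h ▸ Submodule.subset_span hz))
  by_cases hIp : (Submodule.span A (I : Set K)).IsPrincipal
  · -- both principal
    have hNp := hiff.1 hIp
    rw [← coeToSet_coeToSubmodule] at hIp hNp
    have h := NumberRing.exists_ne_zero_span_coe_eq_of_isPrincipal A hIb hNb hIp hNp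
    rwa [coeToSet_coeToSubmodule, coeToSet_coeToSubmodule] at h
  · -- both `≃ 𝔯ᵗ_𝔭` (type `2` necessarily)
    have hNp : ¬ (Submodule.span A (N : Set K)).IsPrincipal := fun h ↦ hIp (hiff.2 h)
    have h2' : Module.finrank (endOrder (Algebra.leftMulMatrix μ) ⧸ 𝔭)
        ((T : Submodule (endOrder (Algebra.leftMulMatrix μ)) K) ⧸
          (𝔭 • ⊤ : Submodule (endOrder (Algebra.leftMulMatrix μ))
            (T : Submodule (endOrder (Algebra.leftMulMatrix μ)) K))) = 2 := by
      by_contra hne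
      have hpos := finrank_traceDual_quotient_pos μ hT h0
      have h1 : Module.finrank (endOrder (Algebra.leftMulMatrix μ) ⧸ 𝔭)
          ((T : Submodule (endOrder (Algebra.leftMulMatrix μ)) K) ⧸
            (𝔭 • ⊤ : Submodule (endOrder (Algebra.leftMulMatrix μ))
              (T : Submodule (endOrder (Algebra.leftMulMatrix μ)) K))) = 1 := by omega
      exact hIp (isPrincipal_span_coe_of_finrank_traceDual_quotient_eq_one μ hT h0 h1 hI hII)
    obtain hP | ⟨x, hx0, hx⟩ :=
      isPrincipal_span_coe_or_exists_span_coe_eq_of_finrank_traceDual_quotient_eq_two μ hT h0 h2' hI hII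
    · exact absurd hP hIp
    obtain hP | ⟨y, hy0, hy⟩ :=
      isPrincipal_span_coe_or_exists_span_coe_eq_of_finrank_traceDual_quotient_eq_two μ hT h0 h2' hN hNN
    · exact absurd hP hNp
    rw [← coeToSet_coeToSubmodule, ← coeToSet_coeToSubmodule] at hx hy
    have h := NumberRing.exists_ne_zero_span_coe_eq_of_span_coe_eq A hx0 hy0 hx hy
    rwa [coeToSet_coeToSubmodule, coeToSet_coeToSubmodule] at h

/-- **THEOREM 6.2 on weak classes: if `type_𝔭(𝔯) ≤ 2` at every prime, two ideals with multiplicator ring `𝔯` are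
weakly equivalent iff, at every prime of type `2`, their local components are simultaneously principal or not** (at
the other primes both are principal; weak equivalence is local isomorphism at every prime).
[cite: Marseglia2024CMType, §6 Thm. 6.2, Cor. 6.5 (proof: «follows from Theorem 6.2 and Lemma 6.4»), pp. 13–15]
[cite: Marseglia2025LocalIsomorphism, §3 Prop. 3.4 ((4) ⟹ (1)), p. 6] -/
theorem one_mem_div_mul_div_iff_forall_isPrincipal_iff {T : FractionalIdeal (endOrder (Algebra.leftMulMatrix μ))⁰ K}
    (hT : (T : Submodule (endOrder (Algebra.leftMulMatrix μ)) K) =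
      traceDual ℤ ℚ ((1 : FractionalIdeal (endOrder (Algebra.leftMulMatrix μ))⁰ K) :
        Submodule (endOrder (Algebra.leftMulMatrix μ)) K))
    (h2 : ∀ 𝔭 : MaximalSpectrum (endOrder (Algebra.leftMulMatrix μ)),
      Module.finrank (endOrder (Algebra.leftMulMatrix μ) ⧸ 𝔭.asIdeal)
        ((T : Submodule (endOrder (Algebra.leftMulMatrix μ)) K) ⧸
          (𝔭.asIdeal • ⊤ : Submodule (endOrder (Algebra.leftMulMatrix μ))
            (T : Submodule (endOrder (Algebra.leftMulMatrix μ)) K))) ≤ 2)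
    {I N : FractionalIdeal (endOrder (Algebra.leftMulMatrix μ))⁰ K} (hI : I ≠ 0) (hII : I / I = 1) (hN : N ≠ 0)
    (hNN : N / N = 1) :
    (1 : K) ∈ I / N * (N / I) ↔
      ∀ 𝔭 : MaximalSpectrum (endOrder (Algebra.leftMulMatrix μ)),
        Module.finrank (endOrder (Algebra.leftMulMatrix μ) ⧸ 𝔭.asIdeal)
          ((T : Submodule (endOrder (Algebra.leftMulMatrix μ)) K) ⧸
            (𝔭.asIdeal • ⊤ : Submodule (endOrder (Algebra.leftMulMatrix μ))
              (T : Submodule (endOrder (Algebra.leftMulMatrix μ)) K))) = 2 →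
        ((Submodule.span (Localization.subalgebra.ofField K 𝔭.asIdeal.primeCompl
            𝔭.asIdeal.primeCompl_le_nonZeroDivisors) (I : Set K)).IsPrincipal ↔
          (Submodule.span (Localization.subalgebra.ofField K 𝔭.asIdeal.primeCompl
            𝔭.asIdeal.primeCompl_le_nonZeroDivisors) (N : Set K)).IsPrincipal) := by
  haveI := isNoetherianRing_endOrder (Algebra.leftMulMatrix μ)
  constructor
  · intro h 𝔭 _
    haveI := 𝔭.isMaximal
    exact isPrincipal_span_coe_iff_of_one_mem_div_mul_div μ hI hN h 𝔭.asIdeal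
  · intro h
    refine EndOrder.one_mem_div_mul_div_of_forall_one_mem_add_coeIdeal hI hN fun 𝔭 _ ↦ ?_
    haveI := 𝔭.isMaximal
    have h0 : 𝔭.asIdeal ≠ ⊥ := Ring.ne_bot_of_isMaximal_of_not_isField 𝔭.isMaximal EndOrder.not_isField
    -- the principality patterns agree at `𝔭` (trivially at type `1`)
    have hiff : (Submodule.span (Localization.subalgebra.ofField K 𝔭.asIdeal.primeCompl
          𝔭.asIdeal.primeCompl_le_nonZeroDivisors) (I : Set K)).IsPrincipal ↔
        (Submodule.span (Localization.subalgebra.ofField K 𝔭.asIdeal.primeCompl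
          𝔭.asIdeal.primeCompl_le_nonZeroDivisors) (N : Set K)).IsPrincipal := by
      by_cases h2𝔭 : Module.finrank (endOrder (Algebra.leftMulMatrix μ) ⧸ 𝔭.asIdeal)
          ((T : Submodule (endOrder (Algebra.leftMulMatrix μ)) K) ⧸
            (𝔭.asIdeal • ⊤ : Submodule (endOrder (Algebra.leftMulMatrix μ))
              (T : Submodule (endOrder (Algebra.leftMulMatrix μ)) K))) = 2
      · exact h 𝔭 h2𝔭
      · have hpos := finrank_traceDual_quotient_pos μ hT h0
        have h1 : Module.finrank (endOrder (Algebra.leftMulMatrix μ) ⧸ 𝔭.asIdeal)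
            ((T : Submodule (endOrder (Algebra.leftMulMatrix μ)) K) ⧸
              (𝔭.asIdeal • ⊤ : Submodule (endOrder (Algebra.leftMulMatrix μ))
                (T : Submodule (endOrder (Algebra.leftMulMatrix μ)) K))) = 1 := by
          have := h2 𝔭; omega
        exact iff_of_true (isPrincipal_span_coe_of_finrank_traceDual_quotient_eq_one μ hT h0 h1 hI hII)
          (isPrincipal_span_coe_of_finrank_traceDual_quotient_eq_one μ hT h0 h1 hN hNN)
    obtain ⟨x, -, hx⟩ := exists_ne_zero_span_coe_eq_of_isPrincipal_iff μ hT h0 (h2 𝔭) hI hII hN hNN hiff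
    exact NumberRing.one_mem_add_coeIdeal_of_span_coe_eq hI hN 𝔭.asIdeal hx

/-! ## §3 LEMMA 6.4 (patching): every principality pattern at the primes of type 2 occurs -/

/-- **LEMMA 6.4 applied as in COROLLARY 6.5: for every set `P` of primes of type `2` there is a fractional ideal `J`
with multiplicator ring `(J:J) = 𝔯` whose local component is principal exactly at the primes of type `2` outside `P`**
(local models `J_𝔭 = 𝔯ᵗ_𝔭` for `𝔭 ∈ P`, `J_𝔭 = 𝔯_𝔭` at the other singular primes, patched by
`CMOrderIdealPrescribedLocalComponents`; at the regular primes `J_𝔭 ≃ 𝔯_𝔭` automatically; `(J:J)` is read off locally).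
[cite: Marseglia2024CMType, §6 Lemma 6.4 and Cor. 6.5, pp. 14–15] -/
theorem exists_div_self_eq_one_forall_isPrincipal_iff {T : FractionalIdeal (endOrder (Algebra.leftMulMatrix μ))⁰ K}
    (hT : (T : Submodule (endOrder (Algebra.leftMulMatrix μ)) K) =
      traceDual ℤ ℚ ((1 : FractionalIdeal (endOrder (Algebra.leftMulMatrix μ))⁰ K) :
        Submodule (endOrder (Algebra.leftMulMatrix μ)) K))
    (P : Set (MaximalSpectrum (endOrder (Algebra.leftMulMatrix μ))))
    (hP : ∀ 𝔭 ∈ P, Module.finrank (endOrder (Algebra.leftMulMatrix μ) ⧸ 𝔭.asIdeal)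
      ((T : Submodule (endOrder (Algebra.leftMulMatrix μ)) K) ⧸
        (𝔭.asIdeal • ⊤ : Submodule (endOrder (Algebra.leftMulMatrix μ))
          (T : Submodule (endOrder (Algebra.leftMulMatrix μ)) K))) = 2) :
    ∃ J : FractionalIdeal (endOrder (Algebra.leftMulMatrix μ))⁰ K, J ≠ 0 ∧ J / J = 1 ∧
      ∀ 𝔭 : MaximalSpectrum (endOrder (Algebra.leftMulMatrix μ)),
        Module.finrank (endOrder (Algebra.leftMulMatrix μ) ⧸ 𝔭.asIdeal)
          ((T : Submodule (endOrder (Algebra.leftMulMatrix μ)) K) ⧸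
            (𝔭.asIdeal • ⊤ : Submodule (endOrder (Algebra.leftMulMatrix μ))
              (T : Submodule (endOrder (Algebra.leftMulMatrix μ)) K))) = 2 →
        ((Submodule.span (Localization.subalgebra.ofField K 𝔭.asIdeal.primeCompl
            𝔭.asIdeal.primeCompl_le_nonZeroDivisors) (J : Set K)).IsPrincipal ↔ 𝔭 ∉ P) := by
  classical
  haveI := isNoetherianRing_endOrder (Algebra.leftMulMatrix μ)
  haveI := dimensionLEOne_endOrder (Algebra.leftMulMatrix μ)
  have hT0 : T ≠ 0 := ne_zero_of_coe_eq_traceDual_one μ hT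
  have hTT : T / T = 1 := traceDual_div_traceDual_eq_of_mul_self_eq μ (one_mul 1) one_ne_zero hT0 hT
  have h10 : (1 : FractionalIdeal (endOrder (Algebra.leftMulMatrix μ))⁰ K) ≠ 0 := one_ne_zero
  -- the singular primes
  set F : Finset (MaximalSpectrum (endOrder (Algebra.leftMulMatrix μ))) :=
    (NumberRing.finite_setOf_le (EndOrder.conductorIdeal_ne_bot (Algebra.leftMulMatrix μ))).toFinset with hF
  have hmemF : ∀ 𝔭 : MaximalSpectrum (endOrder (Algebra.leftMulMatrix μ)),
      𝔭 ∈ F ↔ EndOrder.conductorIdeal (Algebra.leftMulMatrix μ) ≤ 𝔭.asIdeal := fun 𝔭 ↦ by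
    rw [hF, Set.Finite.mem_toFinset]; rfl
  -- local models
  set N : MaximalSpectrum (endOrder (Algebra.leftMulMatrix μ)) →
      FractionalIdeal (endOrder (Algebra.leftMulMatrix μ))⁰ K := fun 𝔭 ↦ if 𝔭 ∈ P then T else 1 with hN
  have hN0 : ∀ 𝔭 ∈ F, N 𝔭 ≠ 0 := fun 𝔭 _ ↦ by
    simp only [hN]; split_ifs; exacts [hT0, h10]
  have hNN : ∀ 𝔭, N 𝔭 / N 𝔭 = 1 := fun 𝔭 ↦ by
    simp only [hN]; split_ifs; exacts [hTT, FractionalIdeal.div_one]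
  obtain ⟨J, hJ0, hJ⟩ := EndOrder.exists_ne_zero_forall_span_coe_eq F N hN0
  -- at every prime `J` is locally isomorphic to `1` or to `T`
  have hloc : ∀ 𝔭 : MaximalSpectrum (endOrder (Algebra.leftMulMatrix μ)), ∃ x : K, x ≠ 0 ∧
      Submodule.span (Localization.subalgebra.ofField K 𝔭.asIdeal.primeCompl 𝔭.asIdeal.primeCompl_le_nonZeroDivisors)
          (J : Set K) =
        Submodule.span (Localization.subalgebra.ofField K 𝔭.asIdeal.primeCompl 𝔭.asIdeal.primeCompl_le_nonZeroDivisors)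
          {x} *
          Submodule.span (Localization.subalgebra.ofField K 𝔭.asIdeal.primeCompl
            𝔭.asIdeal.primeCompl_le_nonZeroDivisors) ((if 𝔭 ∈ F then N 𝔭 else 1 :
              FractionalIdeal (endOrder (Algebra.leftMulMatrix μ))⁰ K) : Set K) := fun 𝔭 ↦ by
    haveI := 𝔭.isMaximal
    by_cases h𝔭F : 𝔭 ∈ F
    · refine ⟨1, one_ne_zero, ?_⟩
      rw [if_pos h𝔭F, hJ 𝔭 h𝔭F, ← Submodule.one_eq_span, one_mul]
    · rw [if_neg h𝔭F]
      exact EndOrder.exists_ne_zero_span_coe_eq_of_not_conductorIdeal_le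
        (Ring.ne_bot_of_isMaximal_of_not_isField 𝔭.isMaximal EndOrder.not_isField) ((hmemF 𝔭).not.1 h𝔭F) hJ0 h10
  refine ⟨J, hJ0, ?_, fun 𝔭 h𝔭2 ↦ ?_⟩
  · -- `(J:J) = 1`, prime by prime
    refine NumberRing.eq_iff_forall_span_coe_eq.2 fun 𝔭 ↦ ?_
    haveI := 𝔭.isMaximal
    obtain ⟨x, hx0, hx⟩ := hloc 𝔭
    have hM0 : (if 𝔭 ∈ F then N 𝔭 else 1 : FractionalIdeal (endOrder (Algebra.leftMulMatrix μ))⁰ K) ≠ 0 := by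
      split_ifs with h; exacts [hN0 𝔭 h, h10]
    rw [NumberRing.span_coe_div_self_eq_of_span_coe_eq hJ0 hM0 𝔭.asIdeal hx]
    split_ifs with h
    · rw [hNN 𝔭]
    · rw [FractionalIdeal.div_one]
  · -- the principality pattern at a prime of type `2` (`𝔭 ∈ F`)
    haveI := 𝔭.isMaximal
    have h0 : 𝔭.asIdeal ≠ ⊥ := Ring.ne_bot_of_isMaximal_of_not_isField 𝔭.isMaximal EndOrder.not_isField
    have h𝔭F : 𝔭 ∈ F := (hmemF 𝔭).2 (conductorIdeal_le_of_finrank_traceDual_quotient_eq_two μ hT h0 h𝔭2)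
    have hJ𝔭 := hJ 𝔭 h𝔭F
    simp only [hN] at hJ𝔭
    by_cases h𝔭P : 𝔭 ∈ P
    · rw [if_pos h𝔭P] at hJ𝔭
      rw [hJ𝔭, iff_false_intro (not_not_intro h𝔭P), iff_false,
        EndOrder.isPrincipal_span_coe_iff_finrank_quotient_eq_one hT0 h0, hP 𝔭 h𝔭P]
      norm_num
    · rw [if_neg h𝔭P] at hJ𝔭
      rw [hJ𝔭, iff_true_intro h𝔭P, iff_true, NumberRing.span_coe_one]
      exact ⟨⟨1, rfl⟩⟩

/-! ## §4 COROLLARY 6.5 = MAIN THEOREM 3 (2): `#W̄(𝔯) = 2^N`, `#ICM_𝔯(𝔯) = 2^N · #Pic(𝔯)` -/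

/-- **MARSEGLIA 2024 COROLLARY 6.5 (the case `T = S`): for an order `𝔯` with `type_𝔭(𝔯) ≤ 2` at every prime, the
number of weak equivalence classes of fractional ideals with multiplicator ring `𝔯` is `#W̄(𝔯) = 2^N`, `N` the number of
primes with `type_𝔭(𝔯) = 2`** — the class of `I` is the set of primes of type `2` where `I_𝔭 ≃ 𝔯ᵗ_𝔭` (THEOREM 6.2),
and every set occurs (LEMMA 6.4). [cite: Marseglia2024CMType, §6 Cor. 6.5, p. 15; §1 Main Theorem 3 (2), p. 3] -/
theorem natCard_quot_stratum_weak_eq_two_pow {T : FractionalIdeal (endOrder (Algebra.leftMulMatrix μ))⁰ K}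
    (hT : (T : Submodule (endOrder (Algebra.leftMulMatrix μ)) K) =
      traceDual ℤ ℚ ((1 : FractionalIdeal (endOrder (Algebra.leftMulMatrix μ))⁰ K) :
        Submodule (endOrder (Algebra.leftMulMatrix μ)) K))
    (h2 : ∀ 𝔭 : MaximalSpectrum (endOrder (Algebra.leftMulMatrix μ)),
      Module.finrank (endOrder (Algebra.leftMulMatrix μ) ⧸ 𝔭.asIdeal)
        ((T : Submodule (endOrder (Algebra.leftMulMatrix μ)) K) ⧸
          (𝔭.asIdeal • ⊤ : Submodule (endOrder (Algebra.leftMulMatrix μ))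
            (T : Submodule (endOrder (Algebra.leftMulMatrix μ)) K))) ≤ 2) :
    Nat.card (Quot fun I N : {I : FractionalIdeal (endOrder (Algebra.leftMulMatrix μ))⁰ K //
        I ≠ 0 ∧ ((I / I : FractionalIdeal (endOrder (Algebra.leftMulMatrix μ))⁰ K) : Set K) =
          (endOrder (Algebra.leftMulMatrix μ) : Set K)} =>
      (1 : K) ∈ (I : FractionalIdeal (endOrder (Algebra.leftMulMatrix μ))⁰ K) / N * (N / I)) =
    2 ^ Nat.card {𝔭 : MaximalSpectrum (endOrder (Algebra.leftMulMatrix μ)) //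
      Module.finrank (endOrder (Algebra.leftMulMatrix μ) ⧸ 𝔭.asIdeal)
        ((T : Submodule (endOrder (Algebra.leftMulMatrix μ)) K) ⧸
          (𝔭.asIdeal • ⊤ : Submodule (endOrder (Algebra.leftMulMatrix μ))
            (T : Submodule (endOrder (Algebra.leftMulMatrix μ)) K))) = 2} := by
  classical
  -- the primes of type `2`
  set P2 : Set (MaximalSpectrum (endOrder (Algebra.leftMulMatrix μ))) := {𝔭 |
      Module.finrank (endOrder (Algebra.leftMulMatrix μ) ⧸ 𝔭.asIdeal)
        ((T : Submodule (endOrder (Algebra.leftMulMatrix μ)) K) ⧸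
          (𝔭.asIdeal • ⊤ : Submodule (endOrder (Algebra.leftMulMatrix μ))
            (T : Submodule (endOrder (Algebra.leftMulMatrix μ)) K))) = 2} with hP2
  haveI : Finite P2 := (finite_setOf_finrank_traceDual_quotient_eq_two μ hT).to_subtype
  -- the invariant: the principality pattern on `P2`
  set φ : {I : FractionalIdeal (endOrder (Algebra.leftMulMatrix μ))⁰ K //
        I ≠ 0 ∧ ((I / I : FractionalIdeal (endOrder (Algebra.leftMulMatrix μ))⁰ K) : Set K) =
          (endOrder (Algebra.leftMulMatrix μ) : Set K)} → P2 → Bool := fun I 𝔭 ↦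
    decide ((Submodule.span (Localization.subalgebra.ofField K 𝔭.1.asIdeal.primeCompl
      𝔭.1.asIdeal.primeCompl_le_nonZeroDivisors) ((I : FractionalIdeal (endOrder (Algebra.leftMulMatrix μ))⁰ K) :
        Set K)).IsPrincipal) with hφ
  have hφeq : ∀ I N : {I : FractionalIdeal (endOrder (Algebra.leftMulMatrix μ))⁰ K //
        I ≠ 0 ∧ ((I / I : FractionalIdeal (endOrder (Algebra.leftMulMatrix μ))⁰ K) : Set K) =
          (endOrder (Algebra.leftMulMatrix μ) : Set K)},
      φ I = φ N ↔ (1 : K) ∈ (I : FractionalIdeal (endOrder (Algebra.leftMulMatrix μ))⁰ K) / N * (N / I) := by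
    intro I N
    rw [one_mem_div_mul_div_iff_forall_isPrincipal_iff μ hT h2 I.2.1 ((coe_div_self_eq_coe_endOrder_iff μ).1 I.2.2)
      N.2.1 ((coe_div_self_eq_coe_endOrder_iff μ).1 N.2.2), funext_iff]
    constructor
    · intro h 𝔭 h𝔭
      have := h ⟨𝔭, h𝔭⟩
      simpa [hφ] using this
    · intro h 𝔭
      have := h 𝔭.1 𝔭.2
      simp only [hφ, this]
  -- `φ` descends to a bijection `W̄(𝔯) → (P2 → Bool)`
  refine (Nat.card_congr (Equiv.ofBijective (Quot.lift φ fun I N h ↦ (hφeq I N).2 h) ⟨?_, ?_⟩)).trans ?_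
  · intro q₁ q₂ h
    induction q₁ using Quot.ind with | mk I => ?_
    induction q₂ using Quot.ind with | mk N => ?_
    exact Quot.sound ((hφeq I N).1 h)
  · intro f
    obtain ⟨J, hJ0, hJJ, hJ⟩ := exists_div_self_eq_one_forall_isPrincipal_iff μ hT
      {𝔭 | ∃ h : 𝔭 ∈ P2, f ⟨𝔭, h⟩ = false} (fun 𝔭 ⟨h, _⟩ ↦ h)
    refine ⟨Quot.mk _ ⟨J, hJ0, (coe_div_self_eq_coe_endOrder_iff μ).2 hJJ⟩, funext fun 𝔭 ↦ ?_⟩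
    change φ ⟨J, hJ0, (coe_div_self_eq_coe_endOrder_iff μ).2 hJJ⟩ 𝔭 = f 𝔭
    have h𝔭 := hJ 𝔭.1 𝔭.2
    simp only [hφ]
    cases hf : f 𝔭
    · rw [decide_eq_false_iff_not, h𝔭, not_not]
      exact ⟨𝔭.2, hf⟩
    · rw [decide_eq_true_iff, h𝔭]
      rintro ⟨_, hf'⟩
      rw [hf] at hf'
      exact Bool.noConfusion hf'
  · rw [Nat.card_fun, Nat.card_eq_fintype_card (α := Bool), Fintype.card_bool]
    rfl

/-- **MARSEGLIA 2024 MAIN THEOREM 3 (2) / COROLLARY 6.5: `#ICM_𝔯(𝔯) = 2^N · #Pic(𝔯)`** for an order with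
`type_𝔭(𝔯) ≤ 2` at every prime, `N` the number of primes of type `2` (THEOREM 4.6 of [Marseglia2019],
`#ICM_S = #W̄k(S)·#Pic(S)`, counted in `CMOrderWeakClassesCount`). [cite: Marseglia2024CMType, §1 Main Theorem 3 (2),
p. 3; §6 Cor. 6.5, p. 15] [cite: Marseglia2019, §4 Thm. 4.6, p. 9] -/
theorem natCard_quot_stratum_eq_two_pow_mul_natCard_quot_pic
    {T : FractionalIdeal (endOrder (Algebra.leftMulMatrix μ))⁰ K}
    (hT : (T : Submodule (endOrder (Algebra.leftMulMatrix μ)) K) =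
      traceDual ℤ ℚ ((1 : FractionalIdeal (endOrder (Algebra.leftMulMatrix μ))⁰ K) :
        Submodule (endOrder (Algebra.leftMulMatrix μ)) K))
    (h2 : ∀ 𝔭 : MaximalSpectrum (endOrder (Algebra.leftMulMatrix μ)),
      Module.finrank (endOrder (Algebra.leftMulMatrix μ) ⧸ 𝔭.asIdeal)
        ((T : Submodule (endOrder (Algebra.leftMulMatrix μ)) K) ⧸
          (𝔭.asIdeal • ⊤ : Submodule (endOrder (Algebra.leftMulMatrix μ))
            (T : Submodule (endOrder (Algebra.leftMulMatrix μ)) K))) ≤ 2) :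
    Nat.card (Quot fun I N : {I : FractionalIdeal (endOrder (Algebra.leftMulMatrix μ))⁰ K //
        I ≠ 0 ∧ ((I / I : FractionalIdeal (endOrder (Algebra.leftMulMatrix μ))⁰ K) : Set K) =
          (endOrder (Algebra.leftMulMatrix μ) : Set K)} =>
      ∃ x : K, x ≠ 0 ∧ (I : FractionalIdeal (endOrder (Algebra.leftMulMatrix μ))⁰ K) =
        spanSingleton (endOrder (Algebra.leftMulMatrix μ))⁰ x * N) =
    2 ^ Nat.card {𝔭 : MaximalSpectrum (endOrder (Algebra.leftMulMatrix μ)) //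
      Module.finrank (endOrder (Algebra.leftMulMatrix μ) ⧸ 𝔭.asIdeal)
        ((T : Submodule (endOrder (Algebra.leftMulMatrix μ)) K) ⧸
          (𝔭.asIdeal • ⊤ : Submodule (endOrder (Algebra.leftMulMatrix μ))
            (T : Submodule (endOrder (Algebra.leftMulMatrix μ)) K))) = 2} *
    Nat.card (Quot fun L N : {L : FractionalIdeal (endOrder (Algebra.leftMulMatrix μ))⁰ K //
        (L ≠ 0 ∧ ((L / L : FractionalIdeal (endOrder (Algebra.leftMulMatrix μ))⁰ K) : Set K) =
          (endOrder (Algebra.leftMulMatrix μ) : Set K)) ∧ L * (L / L / L) = L / L} =>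
      ∃ x : K, x ≠ 0 ∧ (L : FractionalIdeal (endOrder (Algebra.leftMulMatrix μ))⁰ K) =
        spanSingleton (endOrder (Algebra.leftMulMatrix μ))⁰ x * N) := by
  rw [EndOrder.natCard_quot_stratum_eq_natCard_quot_weak_mul_natCard_quot_pic, natCard_quot_stratum_weak_eq_two_pow μ hT h2]

end CMTypeLattice

end Literature.NumberTheory.ComplexMultiplication
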